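import Summits.QuantumFields.YangMills.Theses.UnitScaleTilt
import Summits.QuantumFields.YangMills.Theorems.AlphaInputsT3ACv3Histories
import Summits.QuantumFields.YangMills.Theorems.AlphaInputsT3ACv3Rows
import Summits.QuantumFields.YangMills.Theorems.AlphaInputsT3ACv3SmallFactor
import Summits.QuantumFields.YangMills.Theorems.UnitScaleTiltHistoryTailAlphaConsumer
import Summits.QuantumFields.YangMills.Theorems.UnitScaleTiltHistoryTailDiluteExponentCV3
import Summits.QuantumFields.YangMills.Theorems.UnitScaleTiltHistoryTailHistoryMassWCV3
import Summits.QuantumFields.YangMills.Theorems.UnitScaleTiltHistoryTailLowMassV3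
import HarnessLib

/-!
# Route `UnitScaleTilt` — crux K2-L `HistoryTailL` (stmt-QuantumFields-19936): THE LANE'S CLAUSES AT ITS v3 DATUM, IN THE SHAPES THE CONSUMER COMPOSITION READS
# (fleet lead `ym-ust-18916-p1` g5; `--supports` 19936; part 1/3 of the Theorems landing of skeleton v5p7's sorry-free cone)

Everything here is PROVED from ★alpha-1's v3 (α)-socket deliveries (`AlphaInputsT3ACv3*`), for a family `F` carrying the OPEN hypothesis schema
`AlphaInputsT3AC.OfV3At F 𝔠 a₀ a₁` (never asserted):
* `smallFactorLane_v3` — v5p6's 2″ clause (b) re-typed after F-α1-12 / F-g5-1 (per-plaquette ∃-region small factor at a constant `c ∈ (0, ¼]`) and closed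
  with `c := 1/8`, `R₀ := Run3SmallFactors.regionT (i, plaqCode p′)` by `AlphaInputsT3AC.OfV3At.dataT3v3_smallFactor71_lane` (p514512);
* `laneRows_v3` — (b_c) ∧ (c) `PintSize` at `CP := C46·M₁³` (`dataT3v3_pintSize`, p513495) ∧ (d) the `Zterm` size at `κZ := Alf` (`dataT3v3_ztermSize`, p511457);
* `windowedWeights_v3` — v5p5's 2‴ text at the v3 datum (print's windowed PINNED weights `wtP`: (w0)(w1)(w2)(e′)(e″)(iv), `Bm = 1`) from alpha-1's components, and
  `windowedWeights_v5p5Shape` — the `∃ (γw Bm)` shape the composition consumes.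
Nothing of [Balaban1985UV3] is asserted. [cite: Balaban1985UV3, (40)-(41) p.266, (46)-(47) p.267, (67)-(71) p.273]
-/

set_option autoImplicit false

noncomputable section

open MeasureTheory
open Literature.MathematicalPhysics.QuantumFieldTheory.Balaban1983to89
open Literature.MathematicalPhysics.QuantumFieldTheory.Balaban1983to89.T3ContinuumYM3Torus
open Literature.MathematicalPhysics.QuantumFieldTheory.Balaban1983to89.T3UnitScaleTilt
open Literature.MathematicalPhysics.QuantumFieldTheory.Balaban1983to89.T3UnitLawDensityEML
open Literature.MathematicalPhysics.QuantumFieldTheory.Balaban1983to89.T3ThresholdSmallness (sqrt_coupling_pos_le)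
open Literature.MathematicalPhysics.QuantumFieldTheory.Balaban1983to89.T3Thresholds (coupling_le_one)
open Literature.MathematicalPhysics.QuantumFieldTheory.Balaban1983to89.T3AlphaInputsAC
open Literature.MathematicalPhysics.QuantumFieldTheory.Balaban1983to89.T3AlphaInputsACSchemas
open Literature.MathematicalPhysics.QuantumFieldTheory.Balaban1983to89.B10Eq38TorusDomains (toFine)
open Literature.MathematicalPhysics.QuantumFieldTheory.Balaban1983to89.T3RestrictedUnitDensity (resDensity integrable_resDensity)
open Literature.MathematicalPhysics.QuantumFieldTheory.Balaban1983to89.Missing (partitionFn measurable_plaqHol)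
open Summit.QuantumFields.Balaban3D.Carriers (suGroupModel)
open Summit.QuantumFields.Balaban3D.Proofs.Primitives (AlphaConsts)
open Summit.QuantumFields.Balaban3D.Proofs.Run3SmallFactors (regionT src_mem_plaqCover_of_mem_regionT)
open Summit.QuantumFields.YangMills.Theorems
open Summit.QuantumFields.YangMills.Theorems.HistoryTailDensityTransfer (gibbsK_real_preimage_iter_eq)
open Summit.QuantumFields.YangMills.Theorems.HistoryTailSandwich (partitionFn_eq_integral_resDensity)
open Summit.QuantumFields.YangMills.Theorems.HistoryTailMechanismA (integral_mul_indicator_one_eq_setIntegral)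
open Summit.QuantumFields.YangMills.Theorems.HistoryTailAlphaConsumer (setIntegral_div_integral_le_ae)

namespace Summit.QuantumFields.YangMills.Theorems.HistoryTailLaneRows

open Classical

/-- 2″ — NO LONGER A STUB (v5p7): v5p6's clause (b), RE-TYPED after F-α1-12 in the weakest form the composition consumes and **PROVED BY NAME from ★alpha-1's
`AlphaInputsT3AC.OfV3At.dataT3v3_smallFactor71_lane` (p514512)** with `c := 1/8 = 1/(4N)` and `R₀ := Run3SmallFactors.regionT (i, plaqCode p′)` (cover clause by
`Run3SmallFactors.src_mem_plaqCover_of_mem_regionT`); (a) `LargePSpec` DROPPED as idle (F-g5-1), (c) `PintSize` (p513495) / (d) `Zterm` size (p511457) / (a)-geometry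
(p510829) BY NAME in `laneRows_v5p7` — **THE SMALL FACTORS (70)–(71) OF THE HISTORY'S LARGE-FIELD PLAQUETTES AT THE LANE'S v3 DATUM, IN THE LANE'S NORMALISATION**:
a constant `c ∈ (0, ¼]` and a threshold `γ₂` bound with the record such that for every family of block size `L` carrying the v3 package, every `γ ≤ γ₂`, every admissible
pair `(h, W)` (`Adm = ChargedT3`) of run `K` at level `j ≤ K` and every large-field plaquette `p′ ∈ P_i(h)` (`LargeP K j r i`) there is a finite set `R₀` of fine plaquettes
with base points in `Δ′(p′)` (`Carriers.plaqCover p′`, the four `i`-blocks at the corners of `p′`) with `c·p(g_i)² ≤ β_K·Σ_{q∈R₀}[1 − Re tr U_j(h,W)(∂q)]` (normalised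
trace) — p.273 «the part of the action (1/g_k²)A^η(U_k) localized to the sum of four j-blocks Δ′ … can be bounded from below by ¼p²(g_j)»; `¼ = 1/(4N)` in the normalised
trace of `SU(N)`. [cite: Balaban1985UV3, (67)-(71) p.273] -/
theorem smallFactorLane_v3 :
    ∀ (L : ℕ), Odd L → 1 < L →
      ∀ (𝔠 : AlphaConsts L (suGroupModel 2).N) (a₀ a₁ : ℝ), 0 < a₀ → 0 < a₁ → 𝔠.B₃ * a₁ ≤ a₀ →
        ∃ (γ₂ c : ℝ), 0 < γ₂ ∧ 0 < c ∧ c ≤ 1 / 4 ∧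
          ∀ (F : T3Family) (hF : F.L = L) (h : AlphaInputsT3AC.OfV3At F (hF ▸ 𝔠) a₀ a₁)
            (hc : 0 < a₀ ∧ 0 < a₁ ∧ (hF ▸ 𝔠).B₃ * a₁ ≤ a₀) (γ : ℝ) (hγ : 0 < γ) (hγ1 : γ ≤ (min (hF ▸ 𝔠).gamma0 1) ^ 2)
            (π : AlphaInputsT3AC.PolymerT3 F), γ ≤ γ₂ →
            ∀ (K j : ℕ) (r : (h.lfDataT3v3 hc γ hγ hγ1 π).Reg K j) (v : (i : Fin j) → GaugeField (F.P K) i (Matrix.specialUnitaryGroup (Fin 2) ℂ))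
              (Wf : GaugeField (F.P K) j (Matrix.specialUnitaryGroup (Fin 2) ℂ)), j ≤ K →
              (h.dataT3v3 hc γ hγ hγ1 π).Adm K j ((h.lfDataT3v3 hc γ hγ hγ1 π).assemble K j r v) Wf →
              ∀ (i : ℕ) (p' : Plaq (F.P K) i), p' ∈ (h.lfDataT3v3 hc γ hγ hγ1 π).LargeP K j r i →
                ∃ R₀ : Finset (Plaq (F.P K) 0), (∀ q ∈ R₀, q.src ∈ Summit.QuantumFields.Balaban3D.Carriers.plaqCover p') ∧
                  c * B10.pFun (hF ▸ 𝔠).b₀ (hF ▸ 𝔠).p₀ (Real.sqrt (γ * ((F.L : ℝ)⁻¹) ^ (K - i))) ^ 2 ≤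
                    (F.scheme ℰp γ).β K *
                      ∑ q ∈ R₀, (1 - reTr (GaugeField.plaqHol
                        ((h.dataT3v3 hc γ hγ hγ1 π).Umin K j ((h.lfDataT3v3 hc γ hγ hγ1 π).assemble K j r v) Wf) q)) := by
  intro L hLo hL 𝔠 a₀ a₁ ha0 ha1 hw
  refine ⟨1, 1 / 8, one_pos, by norm_num, by norm_num, fun F hF => ?_⟩
  subst hF
  intro h hc γ hγ hγ1 π _ K j r v Wf hjK hadm i p' hp'
  have hij := (h.lfDataT3v3_largeP_geom hc γ hγ hγ1 π K j hjK r v i p' hp').1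
  exact ⟨regionT (S := T3Scales F γ hγ (hγ1.trans (sq_min_one_le _ 𝔠.gamma0_pos)) K)
      ((i, Summit.QuantumFields.Balaban3D.Carriers.plaqCode p') : ℕ × Summit.QuantumFields.Balaban3D.Carriers.PlaqCode (F.P K)),
    fun q hq => (src_mem_plaqCover_of_mem_regionT (S := T3Scales F γ hγ (hγ1.trans (sq_min_one_le _ 𝔠.gamma0_pos)) K)
      (show i ≤ F.m + K by omega) p' hq).1,
    h.dataT3v3_smallFactor71_lane hc γ hγ hγ1 π K j r v Wf hjK hadm i p' hp'⟩

/-- THE LANE CLAUSES IN THE SHAPE THE COMPOSITION CONSUMES: (b_c) from `smallFactorLane_v3` (p514512), (c) `PintSize` at `CP := C46·M₁³` (★alpha-1 `OfV3At.dataT3v3_pintSize`, p513495) and (d) the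
`Zterm` size at `κZ := Alf` (`OfV3At.dataT3v3_ztermSize`, p511457) BY NAME. [cite: Balaban1985UV3, (41) p.266, (46) p.267 and (67)-(71) p.273] -/
theorem laneRows_v3 :
    ∀ (L : ℕ), Odd L → 1 < L →
      ∀ (𝔠 : AlphaConsts L (suGroupModel 2).N) (a₀ a₁ : ℝ), 0 < a₀ → 0 < a₁ → 𝔠.B₃ * a₁ ≤ a₀ →
        ∃ (γ₂ c CP κZ : ℝ), 0 < γ₂ ∧ 0 < c ∧ c ≤ 1 / 4 ∧ 0 ≤ CP ∧ 0 ≤ κZ ∧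
          ∀ (F : T3Family) (hF : F.L = L) (h : AlphaInputsT3AC.OfV3At F (hF ▸ 𝔠) a₀ a₁)
            (hc : 0 < a₀ ∧ 0 < a₁ ∧ (hF ▸ 𝔠).B₃ * a₁ ≤ a₀) (γ : ℝ) (hγ : 0 < γ) (hγ1 : γ ≤ (min (hF ▸ 𝔠).gamma0 1) ^ 2)
            (π : AlphaInputsT3AC.PolymerT3 F), γ ≤ γ₂ →
            (∀ (K j : ℕ) (r : (h.lfDataT3v3 hc γ hγ hγ1 π).Reg K j) (v : (i : Fin j) → GaugeField (F.P K) i (Matrix.specialUnitaryGroup (Fin 2) ℂ))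
              (Wf : GaugeField (F.P K) j (Matrix.specialUnitaryGroup (Fin 2) ℂ)), j ≤ K →
              (h.dataT3v3 hc γ hγ hγ1 π).Adm K j ((h.lfDataT3v3 hc γ hγ hγ1 π).assemble K j r v) Wf →
              ∀ (i : ℕ) (p' : Plaq (F.P K) i), p' ∈ (h.lfDataT3v3 hc γ hγ hγ1 π).LargeP K j r i →
                ∃ R₀ : Finset (Plaq (F.P K) 0), (∀ q ∈ R₀, q.src ∈ Summit.QuantumFields.Balaban3D.Carriers.plaqCover p') ∧
                  c * B10.pFun (hF ▸ 𝔠).b₀ (hF ▸ 𝔠).p₀ (Real.sqrt (γ * ((F.L : ℝ)⁻¹) ^ (K - i))) ^ 2 ≤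
                    (F.scheme ℰp γ).β K *
                      ∑ q ∈ R₀, (1 - reTr (GaugeField.plaqHol
                        ((h.dataT3v3 hc γ hγ hγ1 π).Umin K j ((h.lfDataT3v3 hc γ hγ hγ1 π).assemble K j r v) Wf) q))) ∧
            PintSize (h.dataT3v3 hc γ hγ hγ1 π) (hF ▸ 𝔠).b₀ (hF ▸ 𝔠).p₀ CP ∧
            (∀ (K j : ℕ) (r : (h.lfDataT3v3 hc γ hγ hγ1 π).Reg K j) (v : (i : Fin j) → GaugeField (F.P K) i (Matrix.specialUnitaryGroup (Fin 2) ℂ)),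
              j ≤ K →
                0 ≤ (h.dataT3v3 hc γ hγ hγ1 π).Zterm K j ((h.lfDataT3v3 hc γ hγ hγ1 π).assemble K j r v) ∧
                (h.dataT3v3 hc γ hγ hγ1 π).Zterm K j ((h.lfDataT3v3 hc γ hγ hγ1 π).assemble K j r v) ≤
                  κZ * ∑ i ∈ Finset.range j,
                    (1 + Real.log (Real.sqrt (γ * ((F.L : ℝ)⁻¹) ^ (K - i)))⁻¹) *
                      (({y : Site (F.P K) i | toFine i y ∉ (h.dataT3v3 hc γ hγ hγ1 π).Ω K j
                          ((h.lfDataT3v3 hc γ hγ hγ1 π).assemble K j r v) (i + 1)} : Set (Site (F.P K) i)).ncard : ℝ)) := by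
  intro L hLo hL 𝔠 a₀ a₁ ha0 ha1 hw
  obtain ⟨γ₂, c, hγ₂, hc0, hc4, hrows⟩ := smallFactorLane_v3 L hLo hL 𝔠 a₀ a₁ ha0 ha1 hw
  refine ⟨γ₂, c, 𝔠.C46 * (𝔠.M₁ : ℝ) ^ 3, 𝔠.Alf, hγ₂, hc0, hc4, by have := 𝔠.C46_nonneg; positivity, 𝔠.Alf_nonneg, fun F hF => ?_⟩
  subst hF
  intro h hc γ hγ hγ1 π hγ₂
  exact ⟨hrows F rfl h hc γ hγ hγ1 π hγ₂, h.dataT3v3_pintSize hc γ hγ hγ1 π, fun K j r v hj => h.dataT3v3_ztermSize hc γ hγ hγ1 π K j r v hj⟩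

/-- 2‴ — NO LONGER A STUB (v5p6: PROVED from ★alpha-1's v3 bundle components, `wt′ := wtP`, print's windowed pinned weights; v5p6-pre: RESTATED IN THE v3-BUNDLE SHAPE — threshold-free, `Bm = 1`, (w2) POINTWISE for `1 ≤ j ≤ K`; = alpha-1's
`AlphaInputsT3AC.windowedWeights_of_v3rows` (p506614) WITHOUT its rows hypothesis and with the weight family existential; at the v3 re-base this stub's body
becomes `⟨_, OfV3At.windowedWeights …⟩` and it stops being a stub) — **THE WINDOWED WEIGHTS** of ALL region histories of the concrete datum (whose regions,
minimiser, `mainT`, `Pint`, `Zterm`, `χ`, `low`, `Rm`, `LargeP` it keeps): (w0) `wt′ ≥ 0`; (w1) `wt′ = 0` on inadmissible histories; (w2) at levels `1 ≤ j ≤ K` a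
non-zero weight charges an admissible pair, for EVERY field (print (40) p.266 «χ_j, j = 1, …, k»; no window at level 0, F-α1-9); (e′) integrable with `∫ wt′ ≤ 1`
(K-uniform; print's masses); (e″) the interaction `Pint_j(r, ·)` measurable; (iv) the upper inductive inequality (41′) a.e. + integrability for the majorant assembled from
`wt′` — the datum `dataT3v3` with `LF` replaced (structure update inline).  On the v2 package this is NOT derivable (F-α1-10/11, P-g18-1); it is print's (55)·(57) content,
delivered by the v3 socket. [cite: Balaban1985UV3, (40)-(41) p.266, (47) p.267 and (55) p.269] -/
theorem windowedWeights_v3 :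
    ∀ (L : ℕ), Odd L → 1 < L →
      ∀ (𝔠 : AlphaConsts L (suGroupModel 2).N) (a₀ a₁ : ℝ), 0 < a₀ → 0 < a₁ → 𝔠.B₃ * a₁ ≤ a₀ →
          ∀ (F : T3Family) (hF : F.L = L) (h : AlphaInputsT3AC.OfV3At F (hF ▸ 𝔠) a₀ a₁)
            (hc : 0 < a₀ ∧ 0 < a₁ ∧ (hF ▸ 𝔠).B₃ * a₁ ≤ a₀) (γ : ℝ) (hγ : 0 < γ) (hγ1 : γ ≤ (min (hF ▸ 𝔠).gamma0 1) ^ 2)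
            (π : AlphaInputsT3AC.PolymerT3 F),
            ∃ wt' : (K j : ℕ) → Summit.QuantumFields.Balaban3D.Carriers.Hist (F.P K) j → GaugeField (F.P K) j (Matrix.specialUnitaryGroup (Fin 2) ℂ) → ℝ,
              (∀ K j r Wf, 0 ≤ wt' K j r Wf) ∧
              (∀ (K j : ℕ) (r : Summit.QuantumFields.Balaban3D.Carriers.Hist (F.P K) j) Wf,
                ¬ Summit.QuantumFields.Balaban3D.Carriers.Hist.Admissible (hF ▸ 𝔠).lane.carrier.M₁
                  (Summit.QuantumFields.Balaban3D.Carriers.rcolOf (T3Scales F γ hγ (hγ1.trans (sq_min_one_le _ (hF ▸ 𝔠).gamma0_pos)) K)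
                    (hF ▸ 𝔠).lane.carrier) j r →
                wt' K j r Wf = 0) ∧
              (∀ (K j : ℕ) (r : Summit.QuantumFields.Balaban3D.Carriers.Hist (F.P K) j), 1 ≤ j → j ≤ K →
                ∀ Wf : GaugeField (F.P K) j (Matrix.specialUnitaryGroup (Fin 2) ℂ),
                  wt' K j r Wf ≠ 0 → (h.dataT3v3 hc γ hγ hγ1 π).Adm K j r Wf) ∧
              (∀ (K j : ℕ) (r : Summit.QuantumFields.Balaban3D.Carriers.Hist (F.P K) j),
                Integrable (wt' K j r) (fieldMeasure (F.P K) j (Matrix.specialUnitaryGroup (Fin 2) ℂ)) ∧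
                ∫ Wf, wt' K j r Wf ∂fieldMeasure (F.P K) j (Matrix.specialUnitaryGroup (Fin 2) ℂ) ≤ 1) ∧
              (∀ (K j : ℕ) (r : Summit.QuantumFields.Balaban3D.Carriers.Hist (F.P K) j), j ≤ K →
                Measurable fun Wf : GaugeField (F.P K) j (Matrix.specialUnitaryGroup (Fin 2) ℂ) => (h.dataT3v3 hc γ hγ hγ1 π).Pint K j r Wf) ∧
              (∀ (K j : ℕ), j ≤ K →
                Ineq41AE ({ h.dataT3v3 hc γ hγ hγ1 π with
                    LF := fun K j Wf Φ => wt' K j (Summit.QuantumFields.Balaban3D.Carriers.Hist.triv (F.P K) j) Wf *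
                        Real.exp (Φ (Summit.QuantumFields.Balaban3D.Carriers.Hist.triv (F.P K) j)) +
                      ∑ r ∈ Finset.univ.erase (Summit.QuantumFields.Balaban3D.Carriers.Hist.triv (F.P K) j),
                        wt' K j r Wf * Real.exp (Φ r) } : AlphaDataT3 F γ) K j ∧
                Integrable (AlphaDataT3.up ({ h.dataT3v3 hc γ hγ hγ1 π with
                    LF := fun K j Wf Φ => wt' K j (Summit.QuantumFields.Balaban3D.Carriers.Hist.triv (F.P K) j) Wf *
                        Real.exp (Φ (Summit.QuantumFields.Balaban3D.Carriers.Hist.triv (F.P K) j)) +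
                      ∑ r ∈ Finset.univ.erase (Summit.QuantumFields.Balaban3D.Carriers.Hist.triv (F.P K) j),
                        wt' K j r Wf * Real.exp (Φ r) } : AlphaDataT3 F γ) K j)
                  (fieldMeasure (F.P K) j (Matrix.specialUnitaryGroup (Fin 2) ℂ))) := by
  intro L _ _ 𝔠 a₀ a₁ _ _ _ F hF
  subst hF
  intro h hc γ hγ hγ1 π
  exact ⟨fun K j r => (h.pkgAtV3 hc γ hγ hγ1 K).wtP j r,
    fun K j r Wf => h.wtP_nonneg hc γ hγ hγ1 K j r Wf,
    fun K j r Wf hr => h.wtP_eq_zero_of_not_admissible hc γ hγ hγ1 K j r Wf hr,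
    fun K j r hj1 hj Wf hW => h.adm_of_wtP_ne_zero hc γ hγ hγ1 π K j hj1 hj r Wf hW,
    fun K j r => h.integrable_wtP_and_integral_le hc γ hγ hγ1 K j r,
    fun K j r hj => h.dataT3v3_measurable_Pint hc γ hγ hγ1 π K j hj r,
    fun K j hj => ⟨h.dataT3v3P_ineq41AE hc γ hγ hγ1 π K j hj, h.dataT3v3P_integrable_up hc γ hγ hγ1 π K j hj⟩⟩

/-- ADAPTER (v5p6-pre): STUB 2‴ in the v3-BUNDLE SHAPE (threshold-free, `Bm = 1`, (w2) POINTWISE for `1 ≤ j ≤ K` — the shape of alpha-1's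
`AlphaInputsT3AC.windowedWeights_of_v3rows` / the v3 theorem `OfV3At.windowedWeights`) implies v5p5's shape (`γw := 1`, `Bm := 1`, (w2) a.e.), which the
composition below consumes unchanged. [folklore] -/
theorem windowedWeights_v5p5Shape :
    ∀ (L : ℕ), Odd L → 1 < L →
      ∀ (𝔠 : AlphaConsts L (suGroupModel 2).N) (a₀ a₁ : ℝ), 0 < a₀ → 0 < a₁ → 𝔠.B₃ * a₁ ≤ a₀ →
        ∃ (γw Bm : ℝ), 0 < γw ∧ 0 ≤ Bm ∧
          ∀ (F : T3Family) (hF : F.L = L) (h : AlphaInputsT3AC.OfV3At F (hF ▸ 𝔠) a₀ a₁)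
            (hc : 0 < a₀ ∧ 0 < a₁ ∧ (hF ▸ 𝔠).B₃ * a₁ ≤ a₀) (γ : ℝ) (hγ : 0 < γ) (hγ1 : γ ≤ (min (hF ▸ 𝔠).gamma0 1) ^ 2)
            (π : AlphaInputsT3AC.PolymerT3 F), γ ≤ γw →
            ∃ wt' : (K j : ℕ) → Summit.QuantumFields.Balaban3D.Carriers.Hist (F.P K) j → GaugeField (F.P K) j (Matrix.specialUnitaryGroup (Fin 2) ℂ) → ℝ,
              (∀ K j r Wf, 0 ≤ wt' K j r Wf) ∧
              (∀ (K j : ℕ) (r : Summit.QuantumFields.Balaban3D.Carriers.Hist (F.P K) j) Wf,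
                ¬ Summit.QuantumFields.Balaban3D.Carriers.Hist.Admissible (hF ▸ 𝔠).lane.carrier.M₁
                  (Summit.QuantumFields.Balaban3D.Carriers.rcolOf (T3Scales F γ hγ (hγ1.trans (sq_min_one_le _ (hF ▸ 𝔠).gamma0_pos)) K)
                    (hF ▸ 𝔠).lane.carrier) j r →
                wt' K j r Wf = 0) ∧
              (∀ (K j : ℕ) (r : Summit.QuantumFields.Balaban3D.Carriers.Hist (F.P K) j), j ≤ K → 1 ≤ j →
                ∀ᵐ Wf ∂fieldMeasure (F.P K) j (Matrix.specialUnitaryGroup (Fin 2) ℂ),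
                  wt' K j r Wf ≠ 0 → (h.dataT3v3 hc γ hγ hγ1 π).Adm K j r Wf) ∧
              (∀ (K j : ℕ) (r : Summit.QuantumFields.Balaban3D.Carriers.Hist (F.P K) j), j ≤ K →
                Integrable (wt' K j r) (fieldMeasure (F.P K) j (Matrix.specialUnitaryGroup (Fin 2) ℂ)) ∧
                ∫ Wf, wt' K j r Wf ∂fieldMeasure (F.P K) j (Matrix.specialUnitaryGroup (Fin 2) ℂ) ≤ Bm) ∧
              (∀ (K j : ℕ) (r : Summit.QuantumFields.Balaban3D.Carriers.Hist (F.P K) j), j ≤ K →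
                Measurable fun Wf : GaugeField (F.P K) j (Matrix.specialUnitaryGroup (Fin 2) ℂ) => (h.dataT3v3 hc γ hγ hγ1 π).Pint K j r Wf) ∧
              (∀ (K j : ℕ), j ≤ K →
                Ineq41AE ({ h.dataT3v3 hc γ hγ hγ1 π with
                    LF := fun K j Wf Φ => wt' K j (Summit.QuantumFields.Balaban3D.Carriers.Hist.triv (F.P K) j) Wf *
                        Real.exp (Φ (Summit.QuantumFields.Balaban3D.Carriers.Hist.triv (F.P K) j)) +
                      ∑ r ∈ Finset.univ.erase (Summit.QuantumFields.Balaban3D.Carriers.Hist.triv (F.P K) j),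
                        wt' K j r Wf * Real.exp (Φ r) } : AlphaDataT3 F γ) K j ∧
                Integrable (AlphaDataT3.up ({ h.dataT3v3 hc γ hγ hγ1 π with
                    LF := fun K j Wf Φ => wt' K j (Summit.QuantumFields.Balaban3D.Carriers.Hist.triv (F.P K) j) Wf *
                        Real.exp (Φ (Summit.QuantumFields.Balaban3D.Carriers.Hist.triv (F.P K) j)) +
                      ∑ r ∈ Finset.univ.erase (Summit.QuantumFields.Balaban3D.Carriers.Hist.triv (F.P K) j),
                        wt' K j r Wf * Real.exp (Φ r) } : AlphaDataT3 F γ) K j)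
                  (fieldMeasure (F.P K) j (Matrix.specialUnitaryGroup (Fin 2) ℂ))) := by
  intro L hLo hL 𝔠 a₀ a₁ ha0 ha1 hw
  refine ⟨1, 1, one_pos, zero_le_one, fun F hF h hc γ hγ hγ1 π _ => ?_⟩
  obtain ⟨wt', h0, h1, h2, h3, h4, h5⟩ := windowedWeights_v3 L hLo hL 𝔠 a₀ a₁ ha0 ha1 hw F hF h hc γ hγ hγ1 π
  exact ⟨wt', h0, h1, fun K j r hjK hj1 => ae_of_all _ (h2 K j r hj1 hjK), fun K j r _ => h3 K j r, h4, h5⟩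

end Summit.QuantumFields.YangMills.Theorems.HistoryTailLaneRows
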